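import Mathlib
import HarnessLib
import Summits.HubbardSuperconductivity.HubbardSuperconductivity.Theorems.KLProgrammeKLRegimeEnginePairTransferMemberFlow
import Summits.HubbardSuperconductivity.HubbardSuperconductivity.Theorems.KLProgrammeKLRegimeEnginePairLadderRelativeReframe
import Literature.MathematicalPhysics.QuantumLattice.GrassmannDefectSplit
import Summits.HubbardSuperconductivity.HubbardSuperconductivity.Theorems.KLProgrammeKLRegimeWickOrderedStep

/-!
# Route `KLProgramme` — ENGINE child gen 8 (stmt-HubbardSuperconductivity-20437 `KLRegimeEngineV17F2`), skeleton v2 class #5 «(S)-transfer» rev 3 (RELATIVE family,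
# INDEX form): the DIFFERENCE of two members — exact identities «every term carries a `D`-line» — `klmf_softCovOf_add`, `klmf_carrier_sub_eq`,
# `klmf_vertexFn_carrier_sub_eq`, `klmf_memberArray_sub_apply`, `klmf_memberDeriv_sub_apply`, `klmf_ladder_sub_eq`, `klmf_defect_sub_le`
# (cell gate-hubbard-kl, seat hubbard-kl-k3c1-p1 g11, technique «composed-map remainder propagation»; KLTC-INDEX-v7 §B.3)

WHY.  In the SIZES bundle of `pairTransferRelAt_succ_keyed` (p592121) the one genuinely RELATIVE analytic input is the relative source
`X_rel = S₁(1 + diag a·A₂) + A₁·diag a·S₂ − S₂`, which `kltc_relSource_le` (p590850) reduces to the difference `S₁ − S₂` of the two members' Riccati defects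
`Sᵢ = Ȧᵢ + Aᵢ·diag ḃᵢ·Aᵢ` plus terms carrying the relative weight `a` (mass ∝ the pair's index mass, `…MemberRates`).  The two members share the SAME effective action
`𝒢^K_Λ`; they differ only in the Wick-ordering covariance, by the CONSTANT matrix `softCovOf K D`, `D = ψ₁ − ψ₂`.  Hence, EXACTLY (Gaussian semigroup `gaussConv_add`):
* `klmf_carrier_sub_eq`: `e^{Δ_{cov₁(Λ)}}G − e^{Δ_{cov₂(Λ)}}G = (e^{Δ_{S_D}} − 1)(e^{Δ_{cov₂(Λ)}}G)` for every `G` (`covᵢ(Λ) = softCovOf ψᵢ + C_{>Λ₁} − C_{>Λ}`);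
* `klmf_memberArray_sub_apply` / `klmf_memberDeriv_sub_apply`: on the bare ball `(A₁ − A₂)(t)(k,k′) = 𝒱₄((e^{Δ_{S_D}} − 1)·𝓜²_{Λ(t)})(labels)` and
  `(Ȧ₁ − Ȧ₂)(t)(k,k′) = (Λ_{n+1} − Λ_n)·(−½)·𝒱₄((e^{Δ_{S_D}} − 1)·e^{Δ_{cov₂}}(δ𝒢/δψ, Ċ δ𝒢/δψ))(labels)` — ONE smearing-Lipschitz estimate type
  (`‖𝒱₄((e^{Δ_{S_D}} − 1)W)‖ ≤ mass(D-line) × norms of W`, the G1-Lip / Gram route) is all the analytic lane owes for the member difference;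
* `klmf_ladder_sub_eq` (exact) + **`klmf_defect_sub_le`**: `‖(S₁ − S₂)(x,y)‖ ≤ ‖(Ȧ₁ − Ȧ₂)(x,y)‖ + m·Σ_c η(x,c)‖ḃ₁_c‖ + m²·Σ_c‖ḃ₁_c − ḃ₂_c‖ + m·Σ_c‖ḃ₂_c‖η(c,y)` from
  `|A₁ − A₂| ≤ η`, `|Aᵢ| ≤ m` — with `Σ‖ḃ₁ − ḃ₂‖ ≤ 2^10·klIdxMass` (`klmf_sum_norm_relRate_le_idx`) and `Σ‖ḃᵢ‖ ≤ 2^10·15367` (`klmf_sum_norm_rate_le`).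
Exact algebra over landed lemmas; nothing about the model's sizes is asserted; nothing asserts superconductivity.  0 kit.
-/

noncomputable section

namespace Summit.HubbardSuperconductivity.HubbardSuperconductivity.Theorems.KLRegimeSplit

set_option linter.dupNamespace false -- summit = problem name (single-conjunct summit), D-0017

open Finset Matrix Set Literature.MathematicalPhysics.QuantumLattice Literature.Probability.LatticeModels GrassmannAlgebra
open Summit.HubbardSuperconductivity.HubbardSuperconductivity.Theorems.KLProgrammeLegKernels
open Summit.HubbardSuperconductivity.HubbardSuperconductivity.Theorems.DispersionFlow
open Summit.HubbardSuperconductivity.HubbardSuperconductivity.Theorems.KLRegimeWick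
open Summit.HubbardSuperconductivity.HubbardSuperconductivity.Theorems.EngineV8

/-! ## §1 The smearing covariance is linear in the symbol; the two carriers differ by `e^{Δ_{S_D}} − 1` -/

section Carrier

variable (L M : ℕ) (β μ : ℝ) (K : TrigPolyC4v)

/-- `softCovOf` is additive in the symbol. -/
theorem klmf_softCovOf_add (φ χ : FreqMomentum L M → ℝ) :
    softCovOf L M β μ K (φ + χ) = softCovOf L M β μ K φ + softCovOf L M β μ K χ := by
  rw [softCovOf, softCovOf, softCovOf, ← normalCovariance_add_symbol]
  congr 1
  funext ks
  simp only [Pi.add_apply]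
  push_cast
  ring

/-- `softCovOf ψ₁ = softCovOf (ψ₁ − ψ₂) + softCovOf ψ₂`. -/
theorem klmf_softCovOf_eq_sub_add (ψ₁ ψ₂ : FreqMomentum L M → ℝ) :
    softCovOf L M β μ K ψ₁ = softCovOf L M β μ K (ψ₁ - ψ₂) + softCovOf L M β μ K ψ₂ := by
  rw [← klmf_softCovOf_add, sub_add_cancel]

variable [NeZero L]

/-- **The two member carriers differ by `e^{Δ_{S_D}} − 1` applied to the second** (any `G`, any `Λ₁, Λ`):
`e^{Δ_{S_{ψ₁} + C_{>Λ₁} − C_{>Λ}}}G − e^{Δ_{S_{ψ₂} + C_{>Λ₁} − C_{>Λ}}}G = e^{Δ_{S_{ψ₁−ψ₂}}}(e^{Δ_{S_{ψ₂} + C_{>Λ₁} − C_{>Λ}}}G) − e^{Δ_{S_{ψ₂} + C_{>Λ₁} − C_{>Λ}}}G`. -/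
theorem klmf_carrier_sub_eq (ψ₁ ψ₂ : FreqMomentum L M → ℝ) (Λ₁ Λ : ℝ) (G : HubbardGrassmann L M) :
    gaussConv ℂ (softCovOf L M β μ K ψ₁ + hubbardCovAboveCT L M β μ 0 K Λ₁ - hubbardCovAboveCT L M β μ 0 K Λ) G -
        gaussConv ℂ (softCovOf L M β μ K ψ₂ + hubbardCovAboveCT L M β μ 0 K Λ₁ - hubbardCovAboveCT L M β μ 0 K Λ) G =
      gaussConv ℂ (softCovOf L M β μ K (ψ₁ - ψ₂))
          (gaussConv ℂ (softCovOf L M β μ K ψ₂ + hubbardCovAboveCT L M β μ 0 K Λ₁ - hubbardCovAboveCT L M β μ 0 K Λ) G) -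
        gaussConv ℂ (softCovOf L M β μ K ψ₂ + hubbardCovAboveCT L M β μ 0 K Λ₁ - hubbardCovAboveCT L M β μ 0 K Λ) G := by
  have h : softCovOf L M β μ K ψ₁ + hubbardCovAboveCT L M β μ 0 K Λ₁ - hubbardCovAboveCT L M β μ 0 K Λ =
      softCovOf L M β μ K (ψ₁ - ψ₂) + (softCovOf L M β μ K ψ₂ + hubbardCovAboveCT L M β μ 0 K Λ₁ - hubbardCovAboveCT L M β μ 0 K Λ) := by
    rw [klmf_softCovOf_eq_sub_add L M β μ K ψ₁ ψ₂]; abel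
  rw [h, gaussConv_add_apply]

/-- **Vertex-function form**: `𝒱_m(e^{Δ_{cov₁}}G) − 𝒱_m(e^{Δ_{cov₂}}G) = 𝒱_m((e^{Δ_{S_D}} − 1)(e^{Δ_{cov₂}}G))`. -/
theorem klmf_vertexFn_carrier_sub_eq (ψ₁ ψ₂ : FreqMomentum L M → ℝ) (Λ₁ Λ : ℝ) (G : HubbardGrassmann L M) (m : ℕ)
    (X : Fin m → HubbardFieldIdx L M) :
    vertexFn L M β (gaussConv ℂ (softCovOf L M β μ K ψ₁ + hubbardCovAboveCT L M β μ 0 K Λ₁ - hubbardCovAboveCT L M β μ 0 K Λ) G) m X -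
        vertexFn L M β (gaussConv ℂ (softCovOf L M β μ K ψ₂ + hubbardCovAboveCT L M β μ 0 K Λ₁ - hubbardCovAboveCT L M β μ 0 K Λ) G) m X =
      vertexFn L M β
        (gaussConv ℂ (softCovOf L M β μ K (ψ₁ - ψ₂))
            (gaussConv ℂ (softCovOf L M β μ K ψ₂ + hubbardCovAboveCT L M β μ 0 K Λ₁ - hubbardCovAboveCT L M β μ 0 K Λ) G) -
          gaussConv ℂ (softCovOf L M β μ K ψ₂ + hubbardCovAboveCT L M β μ 0 K Λ₁ - hubbardCovAboveCT L M β μ 0 K Λ) G) m X := by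
  rw [← klw_vertexFn_sub, klmf_carrier_sub_eq]

end Carrier

/-! ## §2 The member arrays and their flow derivatives differ by `e^{Δ_{S_D}} − 1` (on the bare ball) -/

section Arrays

variable (L M : ℕ) [NeZero L] [NeZero M] (β U μ : ℝ) (K : TrigPolyC4v)

/-- **Difference of the two member arrays along slice `n+1`** (the `A` of `klmf_memberArray_flowData` for `ψ₁` and `ψ₂`), entrywise: on the bare ball it is
`𝒱₄((e^{Δ_{S_D}} − 1)𝓜²_{Λ(t)})(labels)`, off it `0`. -/
theorem klmf_memberArray_sub_apply (n : ℕ) (ψ₁ ψ₂ : FreqMomentum L M → ℝ) (Qm : TorusSite 2 L) (t : ℝ) (k k' : TorusSite 2 L) :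
    ((Matrix.of fun k k' : TorusSite 2 L => if k ∈ klBall L μ 0 ∧ k' ∈ klBall L μ 0 then
        vertexFn L M β (gaussConv ℂ
          (softCovOf L M β μ K ψ₁ + hubbardCovAboveCT L M β μ 0 K (klScale klE0 (n + 1)) -
            hubbardCovAboveCT L M β μ 0 K (klScale klE0 n + t * (klScale klE0 (n + 1) - klScale klE0 n)))
          (hubbardEffectiveActionCT L M β U μ 0 K (klScale klE0 n + t * (klScale klE0 (n + 1) - klScale klE0 n)))) 4
          ![(((omega0 M, k'), 0), 0), ((((omega0 M).rev, Qm - k'), 1), 0), ((((omega0 M).rev, Qm - k), 1), 1), (((omega0 M, k), 0), 1)]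
        else 0) -
      (Matrix.of fun k k' : TorusSite 2 L => if k ∈ klBall L μ 0 ∧ k' ∈ klBall L μ 0 then
        vertexFn L M β (gaussConv ℂ
          (softCovOf L M β μ K ψ₂ + hubbardCovAboveCT L M β μ 0 K (klScale klE0 (n + 1)) -
            hubbardCovAboveCT L M β μ 0 K (klScale klE0 n + t * (klScale klE0 (n + 1) - klScale klE0 n)))
          (hubbardEffectiveActionCT L M β U μ 0 K (klScale klE0 n + t * (klScale klE0 (n + 1) - klScale klE0 n)))) 4
          ![(((omega0 M, k'), 0), 0), ((((omega0 M).rev, Qm - k'), 1), 0), ((((omega0 M).rev, Qm - k), 1), 1), (((omega0 M, k), 0), 1)]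
        else 0)) k k' =
      if k ∈ klBall L μ 0 ∧ k' ∈ klBall L μ 0 then
        vertexFn L M β
          (gaussConv ℂ (softCovOf L M β μ K (ψ₁ - ψ₂))
              (gaussConv ℂ (softCovOf L M β μ K ψ₂ + hubbardCovAboveCT L M β μ 0 K (klScale klE0 (n + 1)) -
                hubbardCovAboveCT L M β μ 0 K (klScale klE0 n + t * (klScale klE0 (n + 1) - klScale klE0 n)))
                (hubbardEffectiveActionCT L M β U μ 0 K (klScale klE0 n + t * (klScale klE0 (n + 1) - klScale klE0 n)))) -
            gaussConv ℂ (softCovOf L M β μ K ψ₂ + hubbardCovAboveCT L M β μ 0 K (klScale klE0 (n + 1)) -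
              hubbardCovAboveCT L M β μ 0 K (klScale klE0 n + t * (klScale klE0 (n + 1) - klScale klE0 n)))
              (hubbardEffectiveActionCT L M β U μ 0 K (klScale klE0 n + t * (klScale klE0 (n + 1) - klScale klE0 n)))) 4
          ![(((omega0 M, k'), 0), 0), ((((omega0 M).rev, Qm - k'), 1), 0), ((((omega0 M).rev, Qm - k), 1), 1), (((omega0 M, k), 0), 1)]
      else 0 := by
  rw [Matrix.sub_apply, Matrix.of_apply, Matrix.of_apply]
  split_ifs with h
  · exact klmf_vertexFn_carrier_sub_eq L M β μ K ψ₁ ψ₂ _ _ _ 4 _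
  · simp

/-- **Difference of the two members' flow derivatives** (the `Ȧ` of `klmf_memberArray_flowData`), entrywise: on the bare ball it is
`(Λ_{n+1} − Λ_n)·(−½)·𝒱₄((e^{Δ_{S_D}} − 1)·e^{Δ_{cov₂}}(δ𝒢/δψ, Ċ δ𝒢/δψ))(labels)`, off it `0`. -/
theorem klmf_memberDeriv_sub_apply (n : ℕ) (ψ₁ ψ₂ : FreqMomentum L M → ℝ) (Qm : TorusSite 2 L) (t : ℝ) (k k' : TorusSite 2 L) :
    ((Matrix.of fun k k' : TorusSite 2 L => if k ∈ klBall L μ 0 ∧ k' ∈ klBall L μ 0 then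
      (klScale klE0 (n + 1) - klScale klE0 n) • -((2 : ℂ)⁻¹ * vertexFn L M β (gaussConv ℂ
        (softCovOf L M β μ K ψ₁ + hubbardCovAboveCT L M β μ 0 K (klScale klE0 (n + 1)) -
          hubbardCovAboveCT L M β μ 0 K (klScale klE0 n + t * (klScale klE0 (n + 1) - klScale klE0 n)))
        (grassmannDerivPairing ℂ
          (Matrix.of fun X Y : HubbardFieldIdx L M => deriv (fun Λ'' : ℝ => hubbardCovAboveCT L M β μ 0 K Λ'' X Y)
            (klScale klE0 n + t * (klScale klE0 (n + 1) - klScale klE0 n)))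
          (hubbardEffectiveActionCT L M β U μ 0 K (klScale klE0 n + t * (klScale klE0 (n + 1) - klScale klE0 n)))
          (hubbardEffectiveActionCT L M β U μ 0 K (klScale klE0 n + t * (klScale klE0 (n + 1) - klScale klE0 n))))) 4
        ![(((omega0 M, k'), 0), 0), ((((omega0 M).rev, Qm - k'), 1), 0), ((((omega0 M).rev, Qm - k), 1), 1), (((omega0 M, k), 0), 1)])
      else 0) -
      (Matrix.of fun k k' : TorusSite 2 L => if k ∈ klBall L μ 0 ∧ k' ∈ klBall L μ 0 then
      (klScale klE0 (n + 1) - klScale klE0 n) • -((2 : ℂ)⁻¹ * vertexFn L M β (gaussConv ℂ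
        (softCovOf L M β μ K ψ₂ + hubbardCovAboveCT L M β μ 0 K (klScale klE0 (n + 1)) -
          hubbardCovAboveCT L M β μ 0 K (klScale klE0 n + t * (klScale klE0 (n + 1) - klScale klE0 n)))
        (grassmannDerivPairing ℂ
          (Matrix.of fun X Y : HubbardFieldIdx L M => deriv (fun Λ'' : ℝ => hubbardCovAboveCT L M β μ 0 K Λ'' X Y)
            (klScale klE0 n + t * (klScale klE0 (n + 1) - klScale klE0 n)))
          (hubbardEffectiveActionCT L M β U μ 0 K (klScale klE0 n + t * (klScale klE0 (n + 1) - klScale klE0 n)))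
          (hubbardEffectiveActionCT L M β U μ 0 K (klScale klE0 n + t * (klScale klE0 (n + 1) - klScale klE0 n))))) 4
        ![(((omega0 M, k'), 0), 0), ((((omega0 M).rev, Qm - k'), 1), 0), ((((omega0 M).rev, Qm - k), 1), 1), (((omega0 M, k), 0), 1)])
      else 0)) k k' =
      if k ∈ klBall L μ 0 ∧ k' ∈ klBall L μ 0 then
        (klScale klE0 (n + 1) - klScale klE0 n) • -((2 : ℂ)⁻¹ * vertexFn L M β
          (gaussConv ℂ (softCovOf L M β μ K (ψ₁ - ψ₂))
              (gaussConv ℂ (softCovOf L M β μ K ψ₂ + hubbardCovAboveCT L M β μ 0 K (klScale klE0 (n + 1)) -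
                hubbardCovAboveCT L M β μ 0 K (klScale klE0 n + t * (klScale klE0 (n + 1) - klScale klE0 n)))
                (grassmannDerivPairing ℂ
                  (Matrix.of fun X Y : HubbardFieldIdx L M => deriv (fun Λ'' : ℝ => hubbardCovAboveCT L M β μ 0 K Λ'' X Y)
                    (klScale klE0 n + t * (klScale klE0 (n + 1) - klScale klE0 n)))
                  (hubbardEffectiveActionCT L M β U μ 0 K (klScale klE0 n + t * (klScale klE0 (n + 1) - klScale klE0 n)))
                  (hubbardEffectiveActionCT L M β U μ 0 K (klScale klE0 n + t * (klScale klE0 (n + 1) - klScale klE0 n))))) -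
            gaussConv ℂ (softCovOf L M β μ K ψ₂ + hubbardCovAboveCT L M β μ 0 K (klScale klE0 (n + 1)) -
              hubbardCovAboveCT L M β μ 0 K (klScale klE0 n + t * (klScale klE0 (n + 1) - klScale klE0 n)))
              (grassmannDerivPairing ℂ
                (Matrix.of fun X Y : HubbardFieldIdx L M => deriv (fun Λ'' : ℝ => hubbardCovAboveCT L M β μ 0 K Λ'' X Y)
                  (klScale klE0 n + t * (klScale klE0 (n + 1) - klScale klE0 n)))
                (hubbardEffectiveActionCT L M β U μ 0 K (klScale klE0 n + t * (klScale klE0 (n + 1) - klScale klE0 n)))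
                (hubbardEffectiveActionCT L M β U μ 0 K (klScale klE0 n + t * (klScale klE0 (n + 1) - klScale klE0 n))))) 4
          ![(((omega0 M, k'), 0), 0), ((((omega0 M).rev, Qm - k'), 1), 0), ((((omega0 M).rev, Qm - k), 1), 1), (((omega0 M, k), 0), 1)])
      else 0 := by
  rw [Matrix.sub_apply, Matrix.of_apply, Matrix.of_apply]
  split_ifs with h
  · simp only [Complex.real_smul]
    rw [← klmf_vertexFn_carrier_sub_eq]
    ring
  · simp

end Arrays

/-! ## §3 The difference of the two Riccati defects -/

section Defect

variable {ι : Type*} [Fintype ι] [DecidableEq ι]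

/-- **Exact**: `A₁·diag ḃ₁·A₁ − A₂·diag ḃ₂·A₂ = (A₁−A₂)·diag ḃ₁·A₁ + A₂·(diag ḃ₁ − diag ḃ₂)·A₁ + A₂·diag ḃ₂·(A₁−A₂)`. -/
theorem klmf_ladder_sub_eq (A₁ A₂ : Matrix ι ι ℂ) (b₁ b₂ : ι → ℂ) :
    A₁ * diagonal b₁ * A₁ - A₂ * diagonal b₂ * A₂ =
      (A₁ - A₂) * diagonal b₁ * A₁ + A₂ * (diagonal b₁ - diagonal b₂) * A₁ + A₂ * diagonal b₂ * (A₁ - A₂) := by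
  noncomm_ring

/-- **The difference of the two Riccati defects** `Sᵢ = Ȧᵢ + Aᵢ·diag ḃᵢ·Aᵢ`, entrywise: from `|A₁ − A₂| ≤ η` (the smearing-Lipschitz estimate of
`klmf_memberArray_sub_apply`), `|Aᵢ| ≤ m`,
`‖(S₁ − S₂)(x,y)‖ ≤ ‖(Ȧ₁ − Ȧ₂)(x,y)‖ + m·Σ_c η(x,c)‖ḃ₁_c‖ + m²·Σ_c ‖ḃ₁_c − ḃ₂_c‖ + m·Σ_c ‖ḃ₂_c‖η(c,y)`. -/
theorem klmf_defect_sub_le (A₁ A₂ A₁' A₂' : Matrix ι ι ℂ) (b₁ b₂ : ι → ℂ) (η : ι → ι → ℝ) {m : ℝ} (hm : 0 ≤ m)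
    (hA₁ : ∀ x y, ‖A₁ x y‖ ≤ m) (hA₂ : ∀ x y, ‖A₂ x y‖ ≤ m) (hη : ∀ x y, ‖(A₁ - A₂) x y‖ ≤ η x y) (x y : ι) :
    ‖((A₁' + A₁ * diagonal b₁ * A₁) - (A₂' + A₂ * diagonal b₂ * A₂)) x y‖ ≤
      ‖(A₁' - A₂') x y‖ + m * ∑ c, η x c * ‖b₁ c‖ + m * m * ∑ c, ‖b₁ c - b₂ c‖ + m * ∑ c, ‖b₂ c‖ * η c y := by
  have e : (A₁' + A₁ * diagonal b₁ * A₁) - (A₂' + A₂ * diagonal b₂ * A₂) =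
      (A₁' - A₂') + ((A₁ - A₂) * diagonal b₁ * A₁ + A₂ * (diagonal b₁ - diagonal b₂) * A₁ + A₂ * diagonal b₂ * (A₁ - A₂)) := by
    rw [← klmf_ladder_sub_eq]; abel
  have hrhs : ‖(A₁' - A₂') x y‖ + m * ∑ c, η x c * ‖b₁ c‖ + m * m * ∑ c, ‖b₁ c - b₂ c‖ + m * ∑ c, ‖b₂ c‖ * η c y =
      ‖(A₁' - A₂') x y‖ + ((m * ∑ c, η x c * ‖b₁ c‖ + m * m * ∑ c, ‖b₁ c - b₂ c‖) + m * ∑ c, ‖b₂ c‖ * η c y) := by ring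
  rw [e, hrhs, Matrix.add_apply, Matrix.add_apply, Matrix.add_apply]
  refine (norm_add_le _ _).trans (add_le_add le_rfl ?_)
  refine (norm_add_le _ _).trans (add_le_add ((norm_add_le _ _).trans (add_le_add ?_ ?_)) ?_)
  · rw [klli_mul_diag_mul_apply, Finset.mul_sum]
    refine (norm_sum_le _ _).trans (sum_le_sum fun c _ => ?_)
    rw [norm_mul, norm_mul]
    have h0 : 0 ≤ η x c := (norm_nonneg _).trans (hη x c)
    calc ‖(A₁ - A₂) x c‖ * ‖b₁ c‖ * ‖A₁ c y‖ ≤ η x c * ‖b₁ c‖ * m :=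
          mul_le_mul (mul_le_mul_of_nonneg_right (hη x c) (norm_nonneg _)) (hA₁ c y) (norm_nonneg _) (mul_nonneg h0 (norm_nonneg _))
      _ = m * (η x c * ‖b₁ c‖) := by ring
  · rw [kltc_mul_diagSub_mul_apply, Finset.mul_sum]
    refine (norm_sum_le _ _).trans (sum_le_sum fun c _ => ?_)
    rw [norm_mul, norm_mul]
    calc ‖A₂ x c‖ * ‖b₁ c - b₂ c‖ * ‖A₁ c y‖ ≤ m * ‖b₁ c - b₂ c‖ * m :=
          mul_le_mul (mul_le_mul_of_nonneg_right (hA₂ x c) (norm_nonneg _)) (hA₁ c y) (norm_nonneg _)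
            (mul_nonneg hm (norm_nonneg _))
      _ = m * m * ‖b₁ c - b₂ c‖ := by ring
  · rw [klli_mul_diag_mul_apply, Finset.mul_sum]
    refine (norm_sum_le _ _).trans (sum_le_sum fun c _ => ?_)
    rw [norm_mul, norm_mul]
    calc ‖A₂ x c‖ * ‖b₂ c‖ * ‖(A₁ - A₂) c y‖ ≤ m * ‖b₂ c‖ * η c y :=
          mul_le_mul (mul_le_mul_of_nonneg_right (hA₂ x c) (norm_nonneg _)) (hη c y) (norm_nonneg _) (mul_nonneg hm (norm_nonneg _))
      _ = m * (‖b₂ c‖ * η c y) := by ring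

end Defect

end Summit.HubbardSuperconductivity.HubbardSuperconductivity.Theorems.KLRegimeSplit

end
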